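import Literature.Probability.RandomPlanarGeometry.CritPercSLELocalityItoProofs
import HarnessLib

/-!
# `κ = 6` is the only SLE satisfying Cardy's formula: the instance `κ = 8` is [LSW04] Thm. 4.7

Topic `Probability/RandomPlanarGeometry`; theorems only (no definition, no new named fact).
A footnote to `CritPercSLELocalityItoProofs` on the named fact
`Literature.Probability.RandomPlanarGeometry.eq_six_of_forall_measureReal_hitsBefore`
(**crit-perc.S21**; W. Werner, *Lectures on two-dimensional critical percolation*, IAS/Park City
Math. Ser. 16 (2009) = arXiv:0710.0856, Sect. 3 §2, p. 19: "The computation (this is "Cardy's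
formula computation for SLE" in Greg Lawler's course) shows that SLE(6) is the only SLE with this
property").

That file proves Werner's statement for every `κ > 0`, `κ ≠ 8`, unconditionally
(`eq_six_of_forall_measureReal_hitsBefore_of_ne_eight`) and shows
`eq_six_of_forall_measureReal_hitsBefore ↔ hasSLETrace_eight`. Here we isolate the one instance
that is not a theorem, `κ = 8`, and show that it contains **no Cardy computation at all**: the
hypothesis of the fact at `κ = 8` — "every chordal SLE₈ law on curve space satisfies Cardy's
crossing formula in every conformal rectangle" — holds **iff SLE₈ is not generated by a curve**
(`forall_measureReal_hitsBefore_eight_iff_not_hasSLETrace_eight`):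

* given the SLE₈ trace (`hasSLETrace_eight`, Lawler–Schramm–Werner (2004), Thm. 4.7) the trace is
  a.s. transient (Rohde–Schramm (2005), Thm. 7.1, Update p. 911 — the theorem
  `RohdeSchramm2005_thm71_eight_holds`), SLE₈ laws exist in every rectangle, and Werner's
  computation run at `κ = 8` (`eq_six_of_forall_measureReal_hitsBefore_of_transient_at`) refutes
  the hypothesis, since `8 ≠ 6` (`not_forall_measureReal_hitsBefore_eight_of_hasSLETrace_eight`);
* without it there is no SLE₈ law on curve space in any Dobrushin domain (`IsSLELaw.hasSLETrace`),
  and the hypothesis is vacuously true (`forall_measureReal_hitsBefore_eight_of_not_hasSLETrace_eight`).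

So the instance `κ = 8` of the fact ("hypothesis at `8` ⇒ `8 = 6`", i.e. "the hypothesis at `8`
fails") is literally the existence theorem [LSW04] Thm. 4.7, the single upstream input on which
the discharge `eq_six_of_forall_measureReal_hitsBefore_holds` waits.

## References

* W. Werner, *Lectures on two-dimensional critical percolation*, IAS/Park City Math. Ser. 16
  (2009), arXiv:0710.0856, Sect. 3 §2 p. 19 [Werner2007].
* S. Rohde, O. Schramm, *Basic properties of SLE*, Ann. of Math. 161 (2005) 883–924, Thm. 7.1 and
  the Update (p. 911) [RohdeSchramm2005].
* G. F. Lawler, O. Schramm, W. Werner, *Conformal invariance of planar loop-erased random walks and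
  uniform spanning trees*, Ann. Probab. 32 (2004) 939–995, Thm. 4.7 [LawlerSchrammWerner2004].
-/

noncomputable section

open Set Filter MeasureTheory
open UpperHalfPlane (upperHalfPlaneSet)
open scoped NNReal

namespace Literature.Probability.RandomPlanarGeometry

/-- **Given the SLE₈ trace, SLE₈ violates Cardy's formula in some conformal rectangle**
([LSW04] Thm. 4.7 ⇒ the hypothesis of crit-perc.S21 fails at `κ = 8`): with `HasSLETrace 8` the
SLE₈ trace is a.s. transient (Rohde–Schramm (2005), Thm. 7.1, Update p. 911:
`RohdeSchramm2005_thm71_eight_holds`), so Werner's computation at `κ = 8`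
(`eq_six_of_forall_measureReal_hitsBefore_of_transient_at`) would give `8 = 6`.
[cite: Werner2007, §3 p. 19] -/
theorem not_forall_measureReal_hitsBefore_eight_of_hasSLETrace_eight (h8 : hasSLETrace_eight) :
    ¬ ∀ (R : ConformalRectangle) (μ : Measure (CurveClass ℂ))
      (φ : ConformalEquiv upperHalfPlaneSet R.carrier) (x : Fin 4 → ℝ),
      IsSLELaw 8 (R.chord 0 2 (by decide)) μ → R.IsUniformizing φ x →
        μ.real (CurveClass.hitsBefore (R.arc 2) (R.arc 1)) = cardyFunction (crossRatio x) := by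
  intro h
  have h86 : (8 : ℝ≥0) = 6 :=
    eq_six_of_forall_measureReal_hitsBefore_of_transient_at (by norm_num)
      (RohdeSchramm2005_thm71_eight_holds h8) h
  norm_num at h86

/-- **Without the SLE₈ trace the hypothesis of crit-perc.S21 at `κ = 8` is vacuous**: an SLE₈ law
on curve space in a Dobrushin domain witnesses `HasSLETrace 8` (`IsSLELaw.hasSLETrace`), so if
SLE₈ is not generated by a curve there is no such law and every universal statement over them
holds. [folklore] -/
theorem forall_measureReal_hitsBefore_eight_of_not_hasSLETrace_eight (h8 : ¬ hasSLETrace_eight) :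
    ∀ (R : ConformalRectangle) (μ : Measure (CurveClass ℂ))
      (φ : ConformalEquiv upperHalfPlaneSet R.carrier) (x : Fin 4 → ℝ),
      IsSLELaw 8 (R.chord 0 2 (by decide)) μ → R.IsUniformizing φ x →
        μ.real (CurveClass.hitsBefore (R.arc 2) (R.arc 1)) = cardyFunction (crossRatio x) :=
  fun _ _ _ _ hμ _ ↦ absurd hμ.hasSLETrace h8

/-- **At `κ = 8` the hypothesis of crit-perc.S21 holds iff SLE₈ is not generated by a curve.**
Hence the instance `κ = 8` of `eq_six_of_forall_measureReal_hitsBefore` is equivalent to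
`hasSLETrace_eight` (Lawler–Schramm–Werner (2004), Thm. 4.7) and involves no Cardy computation;
together with `eq_six_of_forall_measureReal_hitsBefore_of_ne_eight` (all `κ ≠ 8` proved) this is
the content of `eq_six_of_forall_measureReal_hitsBefore_iff_hasSLETrace_eight`, instance by
instance. [cite: LawlerSchrammWerner2004, Thm 4.7] -/
theorem forall_measureReal_hitsBefore_eight_iff_not_hasSLETrace_eight :
    (∀ (R : ConformalRectangle) (μ : Measure (CurveClass ℂ))
      (φ : ConformalEquiv upperHalfPlaneSet R.carrier) (x : Fin 4 → ℝ),
      IsSLELaw 8 (R.chord 0 2 (by decide)) μ → R.IsUniformizing φ x →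
        μ.real (CurveClass.hitsBefore (R.arc 2) (R.arc 1)) = cardyFunction (crossRatio x)) ↔
      ¬ hasSLETrace_eight :=
  ⟨fun h h8 ↦ not_forall_measureReal_hitsBefore_eight_of_hasSLETrace_eight h8 h,
    forall_measureReal_hitsBefore_eight_of_not_hasSLETrace_eight⟩

/-- **The excluded-middle assembly of the named fact, instance by instance**: for every `κ > 0`
the instance of crit-perc.S21 at `κ` holds as soon as either `κ ≠ 8` (proved,
`eq_six_of_forall_measureReal_hitsBefore_of_ne_eight`) or SLE₈ is generated by a curve (then the
hypothesis at `8` is refuted, `not_forall_measureReal_hitsBefore_eight_of_hasSLETrace_eight`).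
[cite: Werner2007, §3 p. 19] -/
theorem eq_six_of_forall_measureReal_hitsBefore_of_ne_eight_or {κ : ℝ≥0} (hκ : 0 < κ)
    (h8 : κ ≠ 8 ∨ hasSLETrace_eight)
    (h : ∀ (R : ConformalRectangle) (μ : Measure (CurveClass ℂ))
      (φ : ConformalEquiv upperHalfPlaneSet R.carrier) (x : Fin 4 → ℝ),
      IsSLELaw κ (R.chord 0 2 (by decide)) μ → R.IsUniformizing φ x →
        μ.real (CurveClass.hitsBefore (R.arc 2) (R.arc 1)) = cardyFunction (crossRatio x)) :
    κ = 6 := by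
  rcases h8 with hκ8 | h8e
  · exact eq_six_of_forall_measureReal_hitsBefore_of_ne_eight hκ hκ8 h
  · rcases eq_or_ne κ 8 with rfl | hκ8
    · exact absurd h (not_forall_measureReal_hitsBefore_eight_of_hasSLETrace_eight h8e)
    · exact eq_six_of_forall_measureReal_hitsBefore_of_ne_eight hκ hκ8 h

end Literature.Probability.RandomPlanarGeometry

end
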